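import Literature.AnabelianGeometry.SemiGraphs.TemperedHbddOfTame
import HarnessLib

/-!
# [SemiAnbd] Thm 3.7 (iii) / Cor 3.9 (R3c) at every graph WITHOUT AN INFINITELY-BRANCHING CORE: the binder `hbdd`,
# (FIX∞).hadj and F-2772 `EdgeLikeCentralizerAt` (ordinal-free Cantor–Bendixson exhaustion of the TAME theorem)

Mochizuki, *Semi-graphs of anabelioids*, Publ. RIMS **42** (2006), §3, Theorem 3.7 (iii), manuscript p. 41
("if `H` fixes two vertices of `𝒢_{∞,j}`, then these two vertices are joined to one another by a single edge")
and Corollary 3.9, proof p. 43 l. 13 ("[again by Theorem 3.7, (iii), (iv)]" — the step the cell names (R3c)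
`EdgeLikeCentralizerAt` / `EdgeLikeCentralizer`, FACT-LIST rows F-2772 / F-2773)
[cite: MochizukiSemiAnbd2006, Cor 3.9 p.43].

PROOF-ONLY (cell abc-iut, block F, seat abc-iut-f-176 gen 4; no definition, no new named fact; no custody file
touched).  The TAME theorem of gen 3 (`TemperedHbddOfTame.lean`) is exhausted to its natural fixed point, WITHOUT
ordinals.  Call a set `S` of vertices of `𝔾` a CORE if it is non-empty and every vertex of `S` carries infinitely
many branches whose edge has ANOTHER branch abutting a vertex of `S`; the displayed hypothesis below is
`NoCore 𝔾`: every non-empty set `S` of vertices has a member with only FINITELY many branches toward `S` (on `𝔾`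
alone; `noCore_of_tame`: TAME ⇒ NoCore ⇐ locally finite; strictly weaker than TAME — e.g. a vertex joined to
infinitely many infinite-valence vertices each with finitely many infinite-valence neighbours; its failure means
exactly that `𝔾` contains an infinitely-branching core: the `ℵ₀`-regular tree, `K_{ℵ₀}`, two vertices joined by
infinitely many edges, one vertex with infinitely many loops, …).

* `VerticialLevelData.dist_le_four_of_noCore` / `hbdd_of_noCore` (abstract level data, merged depth hypothesis
  `hLE` as in `TemperedSeparatingOverInfiniteValence.lean`).  ARGUMENT: let `W` be the set of base vertices under
  a vertex SEPARATING `x k` from `x' k` at some level, `a`, `a'` the base vertices of the two systems.  The turn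
  lemma `exists_fixed_turn` (gen 3) at a separating vertex over `w ∈ W`, with the finite branch set "branches at
  `w` toward `W ∪ {a, a'}`", yields on a deeper fixed geodesic a turn at a lift of `w` with a branch NOT toward
  `W ∪ {a, a'}` — yet along the geodesic PATH it continues (edge-point, opposite branch, vertex:
  `exists_getVert_add_five` / `exists_getVert_sub_three`) to an end (over `a`, `a'`) or to a separating vertex
  (over `W`).  So every `w ∈ W` has infinitely many branches toward `W ∪ {a, a'}`; an edge having exactly two
  branches (`SemiGraph.infinite_toward_symm`), `W` together with those of `a`, `a'` receiving infinitely many edges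
  from `W` is a core — absurd.  Hence no level has a separating vertex: `dist ≤ 4`.
* canonical tower: `hbdd_temperedPiChart_of_noCore`, `hadj_temperedPiChart_of_noCore` (abc-iut-L3-t10's
  `hadj_temperedPiChart_of_bounded_dist'`), `centralizer_le_verticial_of_noCore` (abc-iut-f-172's
  `centralizer_le_of_hadj`, every chart), **`edgeLikeCentralizerAt_of_noCore`** — (R3c) F-2772 at EVERY chart of
  EVERY Cor-3.9 graph of anabelioids whose underlying graph has no core —, **`edgeLikeCentralizer_of_noCore`** —
  F-2773 RESTRICTED to such graphs, hypothesis-free; `noCore_of_tame` (gen 3's TAME class is contained, its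
  second finiteness hypothesis being redundant).

Honest framing: statements about OUR typed tempered fundamental groups; the bare ∀-closure of F-2773 over graphs
WITH an infinitely-branching core is NOT claimed (no `¬∀` witness is known either); cone-irrelevant beyond finite
dual graphs; no side taken on [IUTchIII] Cor. 3.12; typed ≠ proved elsewhere.
-/

namespace Literature.AnabelianGeometry.SemiGraphs

namespace SemiGraph

universe u
variable (G : SemiGraph.{u})

/-- **Edges have two ends**: if infinitely many branches at `w` belong to edges whose OTHER branch abuts `y`, then
infinitely many branches at `y` belong to edges whose other branch abuts `w` (an edge "is a set of cardinality 2",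
[SemiAnbd] §1 p. 11, so "the other branch" is an injection). [cite: MochizukiSemiAnbd2006, §1 p.11] -/
theorem infinite_toward_symm {w y : G.Vertex}
    (h : {b : G.Branch | G.abuts b = some w ∧ ∃ b', b' ≠ b ∧ G.edgeOf b' = G.edgeOf b ∧
      G.abuts b' = some y}.Infinite) :
    {b : G.Branch | G.abuts b = some y ∧ ∃ b', b' ≠ b ∧ G.edgeOf b' = G.edgeOf b ∧
      G.abuts b' = some w}.Infinite := by
  classical
  -- the other branch of the edge of a branch
  have hoth : ∀ b : G.Branch, ∃ b' : G.Branch, b' ≠ b ∧ G.edgeOf b' = G.edgeOf b ∧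
      ∀ d, G.edgeOf d = G.edgeOf b → d = b ∨ d = b' := by
    intro b
    obtain ⟨b₁, b₂, hne, h₁, h₂, hall⟩ := G.two_branches (G.edgeOf b)
    rcases hall b rfl with rfl | rfl
    · exact ⟨b₂, hne.symm, h₂, fun d hd => hall d hd⟩
    · exact ⟨b₁, hne, h₁, fun d hd => (hall d hd).symm⟩
  choose oth hoth_ne hoth_e hoth_all using hoth
  refine Set.infinite_of_injOn_mapsTo (f := oth) ?_ ?_ h
  · -- `oth` is injective
    intro b₁ _ b₂ _ heq
    rcases hoth_all b₁ b₂ (by rw [← hoth_e b₂, ← heq, hoth_e b₁]) with h | h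
    · exact h.symm
    · exact absurd (heq.symm.trans h.symm) (hoth_ne b₂)
  · -- `oth` maps branches at `w` toward `y` to branches at `y` toward `w`
    rintro b ⟨hbw, b', hb'b, hb'e, hb'y⟩
    have hb' : b' = oth b := ((hoth_all b b' hb'e).resolve_left hb'b)
    subst hb'
    exact ⟨hb'y, b, (hoth_ne b).symm, (hoth_e b).symm, hbw⟩

end SemiGraph

/-! ### Over abstract level data: no core ⇒ no separating vertex ⇒ `dist ≤ 4` -/

namespace ProfiniteSemiGraph

namespace VerticialLevelData

open CategoryTheory Topology

universe v u
variable {𝒢 : ProfiniteSemiGraph.{u}} {c : TemperedPiChart 𝒢} (D : VerticialLevelData.{v} 𝒢 c)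

/-- `proj_k (v) = proj_j (trans v)`. [cite: MochizukiSemiAnbd2006, Thm 3.7(iii) p.41] -/
private theorem proj_trans_vertexMap' ⦃j k : D.J⦄ (h : j ≤ k) (v : (D.tree k).Vertex) :
    (D.proj k).vertexMap v = (D.proj j).vertexMap ((D.trans h).vertexMap v) := by
  have e := congrArg (fun φ => SemiGraph.Hom.vertexMap φ v) (D.trans_over h)
  simpa only [SemiGraph.comp_vertexMap, Function.comp_apply] using e.symm

/-- The base vertex of a compatible system is level-independent. [cite: MochizukiSemiAnbd2006, Thm 3.7(iii) p.41] -/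
private theorem proj_vertexMap_eq_of_compat (x : ∀ j, (D.tree j).Vertex)
    (hx : ∀ ⦃i j : D.J⦄ (h : i ≤ j), (D.trans h).vertexMap (x j) = x i) (j k : D.J) :
    (D.proj k).vertexMap (x k) = (D.proj j).vertexMap (x j) := by
  obtain ⟨m, hjm, hkm⟩ := exists_ge_ge j k
  rw [← hx hjm, ← hx hkm, ← D.proj_trans_vertexMap' hjm, ← D.proj_trans_vertexMap' hkm]

/-- On a `C`-fixed walk the edge of a branch-point is `C`-fixed. [cite: MochizukiSemiAnbd2006, Thm 3.7(iii) p.41] -/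
private theorem edgeMap_eq_of_fixed_support' (C : Subgroup c.G) {K : D.J} {z z' : (D.tree K).Node}
    {p : (D.tree K).subdivision.Walk z z'}
    (hfix : ∀ z ∈ p.support, ∀ g ∈ C, SemiGraph.nodeMap (D.act K g) z = z)
    (β : (D.tree K).Branch) (hβ : (Sum.inr (Sum.inr β) : (D.tree K).Node) ∈ p.support) :
    ∀ g ∈ C, (D.act K g).hom.edgeMap ((D.tree K).edgeOf β) = (D.tree K).edgeOf β := by
  intro g hg
  have h := hfix _ hβ g hg
  simp only [SemiGraph.nodeMap_inr_inr, Sum.inr.injEq] at h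
  rw [← (D.act K g).hom.edgeOf_branchMap β, h]

/-- **No core ⇒ `dist ≤ 4`** ([SemiAnbd] Thm 3.7 (iii), second sentence, at every base graph WITHOUT an
infinitely-branching core).  With `D`, `C`, `hLE`, `x`, `x'` as in `dist_le_four_of_tame`, if every non-empty set
`S` of base vertices has a member with only finitely many branches whose edge has another branch abutting a vertex
of `S` (`hNC`), then `x j`, `x' j` are equal or the two ends of one edge at every level: the set `W` of base vertices
under separating vertices of the geodesics, enlarged by those of `base x`, `base x'` receiving infinitely many edges
from `W`, would otherwise be a core. [cite: MochizukiSemiAnbd2006, Thm 3.7(iii) p.41] -/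
theorem dist_le_four_of_noCore (C : Subgroup c.G)
    (hLE : ∀ (w : 𝒢.graph.Vertex) (B : Set 𝒢.graph.Branch), B.Finite →
      (∀ b ∈ B, 𝒢.graph.abuts b = some w) → ∀ j : D.J, ∃ (k : D.J) (hjk : j ≤ k),
      ∀ (v : (D.tree k).Vertex), (D.proj k).vertexMap v = w →
      ∀ (β₁ β₂ : (D.tree k).Branch), (D.tree k).abuts β₁ = some v → (D.tree k).abuts β₂ = some v →
      (D.proj k).branchMap β₁ ∈ B → (D.proj k).branchMap β₂ ∈ B →
      (∀ g ∈ C, (D.act k g).hom.edgeMap ((D.tree k).edgeOf β₁) = (D.tree k).edgeOf β₁) →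
      (∀ g ∈ C, (D.act k g).hom.edgeMap ((D.tree k).edgeOf β₂) = (D.tree k).edgeOf β₂) →
      (D.trans hjk).branchMap β₁ = (D.trans hjk).branchMap β₂)
    (hNC : ∀ S : Set 𝒢.graph.Vertex, S.Nonempty → ∃ w ∈ S,
      {b : 𝒢.graph.Branch | 𝒢.graph.abuts b = some w ∧ ∃ b', b' ≠ b ∧ 𝒢.graph.edgeOf b' = 𝒢.graph.edgeOf b ∧
        ∃ w' ∈ S, 𝒢.graph.abuts b' = some w'}.Finite)
    (x x' : ∀ j, (D.tree j).Vertex)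
    (hx : ∀ ⦃i j : D.J⦄ (h : i ≤ j), (D.trans h).vertexMap (x j) = x i)
    (hx' : ∀ ⦃i j : D.J⦄ (h : i ≤ j), (D.trans h).vertexMap (x' j) = x' i)
    (hfx : ∀ g ∈ C, ∀ j, (D.act j g).hom.vertexMap (x j) = x j)
    (hfx' : ∀ g ∈ C, ∀ j, (D.act j g).hom.vertexMap (x' j) = x' j) (j : D.J) :
    (D.tree j).subdivision.dist (Sum.inl (x j)) (Sum.inl (x' j)) ≤ 4 := by
  classical
  by_contra hfar
  obtain ⟨u, hu, hu', hsep⟩ := SemiGraph.exists_separating_of_four_lt_dist (D.isTree j).isTree hfar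
  -- base points of the two systems (level-independent)
  set a := (D.proj j).vertexMap (x j) with ha
  set a' := (D.proj j).vertexMap (x' j) with ha'
  have hxa : ∀ k, (D.proj k).vertexMap (x k) = a := fun k => D.proj_vertexMap_eq_of_compat x hx j k
  have hxa' : ∀ k, (D.proj k).vertexMap (x' k) = a' := fun k => D.proj_vertexMap_eq_of_compat x' hx' j k
  -- the base vertices under separating vertices, at all levels
  let W : Set 𝒢.graph.Vertex := {w | ∃ (k : D.J) (v : (D.tree k).Vertex), v ≠ x k ∧ v ≠ x' k ∧
    (∀ q : (D.tree k).subdivision.Walk (Sum.inl (x k)) (Sum.inl (x' k)),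
      (Sum.inl v : (D.tree k).Node) ∈ q.support) ∧ (D.proj k).vertexMap v = w}
  -- branches at `w` whose edge has another branch abutting a vertex satisfying `P`
  let T : 𝒢.graph.Vertex → (𝒢.graph.Vertex → Prop) → Set 𝒢.graph.Branch := fun w P =>
    {b | 𝒢.graph.abuts b = some w ∧ ∃ b', b' ≠ b ∧ 𝒢.graph.edgeOf b' = 𝒢.graph.edgeOf b ∧
      ∃ w', 𝒢.graph.abuts b' = some w' ∧ P w'}
  -- CLAIM 1: every `w ∈ W` has infinitely many branches toward `W ∪ {a, a'}`
  have hW : ∀ w ∈ W, (T w fun w' => w' ∈ W ∨ w' = a ∨ w' = a').Infinite := by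
    rintro w ⟨k, u₀, hu₀, hu₀', hsep₀, rfl⟩ hBfin
    obtain ⟨K, hkK, hK⟩ := hLE _ _ hBfin (fun b hb => hb.1) k
    obtain ⟨p, hpp, hfix, i, ũ, β₁, β₂, hi, hi₁, hũ, hi₂, hβ₁, hβ₂, hũu, hne⟩ :=
      D.exists_fixed_turn C x x' hx hx' hfx hfx' hkK u₀ hu₀ hu₀' hsep₀
    have hTK := (D.isTree K).isTree
    have hũw : (D.proj K).vertexMap ũ = (D.proj k).vertexMap u₀ := by
      rw [D.proj_trans_vertexMap' hkK, hũu]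
    -- not both base branches of the turn are toward `W ∪ {a, a'}`
    have hout : (D.proj K).branchMap β₁ ∉ T ((D.proj k).vertexMap u₀) (fun w' => w' ∈ W ∨ w' = a ∨ w' = a') ∨
        (D.proj K).branchMap β₂ ∉ T ((D.proj k).vertexMap u₀) (fun w' => w' ∈ W ∨ w' = a ∨ w' = a') := by
      by_contra h
      rw [not_or, not_not, not_not] at h
      exact hne (hK ũ hũw β₁ β₂ hβ₁ hβ₂ h.1 h.2
        (D.edgeMap_eq_of_fixed_support' C hfix β₁ (hi₁ ▸ p.getVert_mem_support i))
        (D.edgeMap_eq_of_fixed_support' C hfix β₂ (hi₂ ▸ p.getVert_mem_support (i + 2))))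
    -- every vertex of the geodesic lies over `W`, over `a`, or over `a'`
    have hvert : ∀ (n : ℕ) (v : (D.tree K).Vertex), n ≤ p.length → p.getVert n = Sum.inl v →
        (D.proj K).vertexMap v ∈ W ∨ (D.proj K).vertexMap v = a ∨ (D.proj K).vertexMap v = a' := by
      intro n v hn hv
      by_cases h0 : n = 0
      · subst h0
        rw [SimpleGraph.Walk.getVert_zero] at hv
        exact Or.inr (Or.inl (by rw [← Sum.inl_injective hv, hxa K]))
      by_cases hl : n = p.length
      · subst hl
        rw [SimpleGraph.Walk.getVert_length] at hv
        exact Or.inr (Or.inr (by rw [← Sum.inl_injective hv, hxa' K]))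
      refine Or.inl ⟨K, v, ?_, ?_, fun q => SemiGraph.mem_support_of_mem_support_path hTK.isAcyclic p hpp
        (hv ▸ p.getVert_mem_support n) q, rfl⟩
      · rintro rfl
        refine h0 (hpp.getVert_injOn (by rw [Set.mem_setOf_eq]; omega) (by rw [Set.mem_setOf_eq]; omega) ?_)
        rw [hv, SimpleGraph.Walk.getVert_zero]
      · rintro rfl
        refine hl (hpp.getVert_injOn (by rw [Set.mem_setOf_eq]; omega) (by rw [Set.mem_setOf_eq]) ?_)
        rw [hv, SimpleGraph.Walk.getVert_length]
    rcases hout with h₁ | h₂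
    · -- backwards along the geodesic: `β₁`'s edge leads to `p_{i-3}`
      obtain ⟨β₁', v', hβ₁'ne, hβ₁'e, hβ₁'v, h3i, hv'⟩ :=
        SemiGraph.exists_getVert_sub_three hpp (by omega) hũ hi₁
      exact h₁ ⟨by rw [(D.proj K).abuts_branchMap β₁ ũ hβ₁, hũw], (D.proj K).branchMap β₁',
        fun h => hβ₁'ne ((D.proj K).branchMap_injOn _ _ hβ₁'e h),
        by rw [(D.proj K).edgeOf_branchMap, (D.proj K).edgeOf_branchMap, hβ₁'e],
        (D.proj K).vertexMap v', (D.proj K).abuts_branchMap β₁' v' hβ₁'v, hvert (i - 3) v' (by omega) hv'⟩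
    · -- forwards along the geodesic: `β₂`'s edge leads to `p_{i+5}`
      obtain ⟨β₂', v', hβ₂'ne, hβ₂'e, hβ₂'v, hi5, hv'⟩ :=
        SemiGraph.exists_getVert_add_five hpp hi hũ hi₂
      exact h₂ ⟨by rw [(D.proj K).abuts_branchMap β₂ ũ hβ₂, hũw], (D.proj K).branchMap β₂',
        fun h => hβ₂'ne ((D.proj K).branchMap_injOn _ _ hβ₂'e h),
        by rw [(D.proj K).edgeOf_branchMap, (D.proj K).edgeOf_branchMap, hβ₂'e],
        (D.proj K).vertexMap v', (D.proj K).abuts_branchMap β₂' v' hβ₂'v, hvert (i + 5) v' hi5 hv'⟩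
  -- CLAIM 2: `W`, enlarged by the ends `a`, `a'` receiving infinitely many edges from `W`, is a core
  let S : Set 𝒢.graph.Vertex := W ∪ {y | (y = a ∨ y = a') ∧ (T y fun w' => w' ∈ W).Infinite}
  have hWS : W ⊆ S := Set.subset_union_left
  have hSne : S.Nonempty := ⟨(D.proj j).vertexMap u, hWS ⟨j, u, hu, hu', hsep, rfl⟩⟩
  obtain ⟨w, hwS, hwfin⟩ := hNC S hSne
  -- branches at `w` toward a subset of `S` are finitely many
  have hmono : ∀ X : Set 𝒢.graph.Vertex, X ⊆ S → (T w fun w' => w' ∈ X).Finite := by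
    intro X hX
    refine hwfin.subset ?_
    rintro b ⟨hb, b', hb'b, hb'e, w', hb'w, hw'⟩
    exact ⟨hb, b', hb'b, hb'e, w', hX hw', hb'w⟩
  rcases hwS with hwW | ⟨hwa, hwinf⟩
  · -- `w ∈ W`: an end receiving infinitely many edges from `w` would be in `S` — so all three parts are finite
    have hend : ∀ y : 𝒢.graph.Vertex, (y = a ∨ y = a') →
        ¬ {b : 𝒢.graph.Branch | 𝒢.graph.abuts b = some w ∧ ∃ b', b' ≠ b ∧
          𝒢.graph.edgeOf b' = 𝒢.graph.edgeOf b ∧ 𝒢.graph.abuts b' = some y}.Infinite := by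
      intro y hy hinf
      have hyS : y ∈ S := by
        refine Or.inr ⟨hy, (𝒢.graph.infinite_toward_symm hinf).mono ?_⟩
        rintro b ⟨hb, b', hb'b, hb'e, hb'w⟩
        exact ⟨hb, b', hb'b, hb'e, w, hb'w, hwW⟩
      refine hinf ((hmono {y} (Set.singleton_subset_iff.2 hyS)).subset ?_)
      rintro b ⟨hb, b', hb'b, hb'e, hb'y⟩
      exact ⟨hb, b', hb'b, hb'e, y, hb'y, rfl⟩
    refine hW w hwW (((hmono W hWS).union ((Set.not_infinite.1 (hend a (Or.inl rfl))).union
      (Set.not_infinite.1 (hend a' (Or.inr rfl))))).subset ?_)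
    rintro b ⟨hb, b', hb'b, hb'e, w', hb'w, hw' | rfl | rfl⟩
    · exact Or.inl ⟨hb, b', hb'b, hb'e, w', hb'w, hw'⟩
    · exact Or.inr (Or.inl ⟨hb, b', hb'b, hb'e, hb'w⟩)
    · exact Or.inr (Or.inr ⟨hb, b', hb'b, hb'e, hb'w⟩)
  · -- `w = a` or `w = a'` receiving infinitely many edges from `W ⊆ S`: absurd
    exact hwinf (hmono W hWS)

/-- **The binder `hbdd` (bound `4`) over abstract level data at a base graph without core.**
[cite: MochizukiSemiAnbd2006, Thm 3.7(iii) p.41] -/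
theorem hbdd_of_noCore (C : Subgroup c.G)
    (hLE : ∀ (w : 𝒢.graph.Vertex) (B : Set 𝒢.graph.Branch), B.Finite →
      (∀ b ∈ B, 𝒢.graph.abuts b = some w) → ∀ j : D.J, ∃ (k : D.J) (hjk : j ≤ k),
      ∀ (v : (D.tree k).Vertex), (D.proj k).vertexMap v = w →
      ∀ (β₁ β₂ : (D.tree k).Branch), (D.tree k).abuts β₁ = some v → (D.tree k).abuts β₂ = some v →
      (D.proj k).branchMap β₁ ∈ B → (D.proj k).branchMap β₂ ∈ B →
      (∀ g ∈ C, (D.act k g).hom.edgeMap ((D.tree k).edgeOf β₁) = (D.tree k).edgeOf β₁) →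
      (∀ g ∈ C, (D.act k g).hom.edgeMap ((D.tree k).edgeOf β₂) = (D.tree k).edgeOf β₂) →
      (D.trans hjk).branchMap β₁ = (D.trans hjk).branchMap β₂)
    (hNC : ∀ S : Set 𝒢.graph.Vertex, S.Nonempty → ∃ w ∈ S,
      {b : 𝒢.graph.Branch | 𝒢.graph.abuts b = some w ∧ ∃ b', b' ≠ b ∧ 𝒢.graph.edgeOf b' = 𝒢.graph.edgeOf b ∧
        ∃ w' ∈ S, 𝒢.graph.abuts b' = some w'}.Finite)
    (x x' : ∀ j, (D.tree j).Vertex)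
    (hx : ∀ ⦃i j : D.J⦄ (h : i ≤ j), (D.trans h).vertexMap (x j) = x i)
    (hx' : ∀ ⦃i j : D.J⦄ (h : i ≤ j), (D.trans h).vertexMap (x' j) = x' i)
    (hfx : ∀ g ∈ C, ∀ j, (D.act j g).hom.vertexMap (x j) = x j)
    (hfx' : ∀ g ∈ C, ∀ j, (D.act j g).hom.vertexMap (x' j) = x' j) :
    ∃ N : ℕ, ∀ j, (D.tree j).subdivision.dist (Sum.inl (x j)) (Sum.inl (x' j)) ≤ N :=
  ⟨4, D.dist_le_four_of_noCore C hLE hNC x x' hx hx' hfx hfx'⟩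

end VerticialLevelData

/-! ### The canonical tower: `hbdd`, (FIX∞).hadj, centralisers, (R3c) at graphs without core -/

section Canonical

open CategoryTheory Topology

universe u
variable (𝒢 : ProfiniteSemiGraph.{u}) {ℋ : ProfiniteSemiGraph.{u}}

/-- **TAME ⇒ no core** (so this file supersedes `TemperedHbddOfTame.lean`): if every vertex of infinite valence has
only finitely many branches whose edge has another branch abutting a vertex of infinite valence, then every
non-empty set of vertices has a member with finitely many branches toward the set — any member will do, since all
members of a would-be core have infinite valence.  (The second TAME hypothesis `hTmul` is not needed.)
[cite: MochizukiSemiAnbd2006, Thm 3.7(iii) p.41] -/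
theorem noCore_of_tame
    (hTinf : ∀ w : 𝒢.graph.Vertex, {b | 𝒢.graph.abuts b = some w}.Infinite →
      {b : 𝒢.graph.Branch | 𝒢.graph.abuts b = some w ∧ ∃ b', b' ≠ b ∧ 𝒢.graph.edgeOf b' = 𝒢.graph.edgeOf b ∧
        ∃ w', 𝒢.graph.abuts b' = some w' ∧ {b'' | 𝒢.graph.abuts b'' = some w'}.Infinite}.Finite) :
    ∀ S : Set 𝒢.graph.Vertex, S.Nonempty → ∃ w ∈ S,
      {b : 𝒢.graph.Branch | 𝒢.graph.abuts b = some w ∧ ∃ b', b' ≠ b ∧ 𝒢.graph.edgeOf b' = 𝒢.graph.edgeOf b ∧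
        ∃ w' ∈ S, 𝒢.graph.abuts b' = some w'}.Finite := by
  intro S ⟨w₀, hw₀⟩
  by_contra h
  push Not at h
  -- every member of `S` has infinite valence
  have hval : ∀ w ∈ S, {b | 𝒢.graph.abuts b = some w}.Infinite := fun w hw =>
    (Set.not_finite.1 (h w hw)).mono fun b hb => hb.1
  refine Set.not_finite.1 (h w₀ hw₀) ((hTinf w₀ (hval w₀ hw₀)).subset ?_)
  rintro b ⟨hb, b', hb'b, hb'e, w', hw', hb'w⟩
  exact ⟨hb, b', hb'b, hb'e, w', hb'w, hval w' hw'⟩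

/-- **`hbdd` (bound `4`) at the canonical tower of a `𝒢` without core, any valence**: for `𝒢` satisfying the
hypotheses of Thm 3.7 whose underlying graph has no infinitely-branching core (`hNC`), any two compatible vertex
systems of the canonical tower fixed by a subgroup `C ≠ 1` are, at every level, equal or the two ends of one edge.
[cite: MochizukiSemiAnbd2006, Thm 3.7(iii) p.41] -/
theorem hbdd_temperedPiChart_of_noCore (h37 : 𝒢.Thm37Hypotheses)
    (hNC : ∀ S : Set 𝒢.graph.Vertex, S.Nonempty → ∃ w ∈ S,
      {b : 𝒢.graph.Branch | 𝒢.graph.abuts b = some w ∧ ∃ b', b' ≠ b ∧ 𝒢.graph.edgeOf b' = 𝒢.graph.edgeOf b ∧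
        ∃ w' ∈ S, 𝒢.graph.abuts b' = some w'}.Finite)
    (C : Subgroup (𝒢.temperedPiChart h37.toProp36Hypotheses).G) (hC : C ≠ ⊥)
    (x x' : ∀ j, ((verticialLevelData_temperedPiChart (h36 := h37.toProp36Hypotheses)).tree j).Vertex)
    (hx : ∀ ⦃i j : ℕ⦄ (hij : i ≤ j), ((verticialLevelData_temperedPiChart (h36 := h37.toProp36Hypotheses)).trans hij).vertexMap (x j) = x i)
    (hx' : ∀ ⦃i j : ℕ⦄ (hij : i ≤ j), ((verticialLevelData_temperedPiChart (h36 := h37.toProp36Hypotheses)).trans hij).vertexMap (x' j) = x' i)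
    (hfx : ∀ g ∈ C, ∀ j, ((verticialLevelData_temperedPiChart (h36 := h37.toProp36Hypotheses)).act j g).hom.vertexMap (x j) = x j)
    (hfx' : ∀ g ∈ C, ∀ j, ((verticialLevelData_temperedPiChart (h36 := h37.toProp36Hypotheses)).act j g).hom.vertexMap (x' j) = x' j) :
    ∃ N : ℕ, ∀ j, ((verticialLevelData_temperedPiChart (h36 := h37.toProp36Hypotheses)).tree j).subdivision.dist
      (Sum.inl (x j)) (Sum.inl (x' j)) ≤ N :=
  (verticialLevelData_temperedPiChart (h36 := h37.toProp36Hypotheses)).hbdd_of_noCore C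
    (fun w B hB hBw j => 𝒢.leFinset_temperedPiChart h37 C hC w B hB hBw j) hNC x x' hx hx' hfx hfx'

/-- **(FIX∞).hadj at the canonical tower of a `𝒢` without core, any valence** (abc-iut-L3-t10's
`hadj_temperedPiChart_of_bounded_dist'` with its bound supplied by `hbdd_temperedPiChart_of_noCore`): two
compatible vertex systems fixed by a compact `C ≠ 1` are, at every level where they differ, the two ends of a
`C`-fixed edge. [cite: MochizukiSemiAnbd2006, Thm 3.7(iii) p.41] -/
theorem hadj_temperedPiChart_of_noCore (h37 : 𝒢.Thm37Hypotheses)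
    (hNC : ∀ S : Set 𝒢.graph.Vertex, S.Nonempty → ∃ w ∈ S,
      {b : 𝒢.graph.Branch | 𝒢.graph.abuts b = some w ∧ ∃ b', b' ≠ b ∧ 𝒢.graph.edgeOf b' = 𝒢.graph.edgeOf b ∧
        ∃ w' ∈ S, 𝒢.graph.abuts b' = some w'}.Finite)
    (C : Subgroup (𝒢.temperedPiChart h37.toProp36Hypotheses).G)
    (hCc : IsCompact (C : Set (𝒢.temperedPiChart h37.toProp36Hypotheses).G)) (hC : C ≠ ⊥)
    (x x' : ∀ j, ((verticialLevelData_temperedPiChart (h36 := h37.toProp36Hypotheses)).tree j).Vertex)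
    (hx : ∀ ⦃i j : ℕ⦄ (hij : i ≤ j), ((verticialLevelData_temperedPiChart (h36 := h37.toProp36Hypotheses)).trans hij).vertexMap (x j) = x i)
    (hx' : ∀ ⦃i j : ℕ⦄ (hij : i ≤ j), ((verticialLevelData_temperedPiChart (h36 := h37.toProp36Hypotheses)).trans hij).vertexMap (x' j) = x' i)
    (hfx : ∀ g ∈ C, ∀ j, ((verticialLevelData_temperedPiChart (h36 := h37.toProp36Hypotheses)).act j g).hom.vertexMap (x j) = x j)
    (hfx' : ∀ g ∈ C, ∀ j, ((verticialLevelData_temperedPiChart (h36 := h37.toProp36Hypotheses)).act j g).hom.vertexMap (x' j) = x' j)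
    (j : ℕ) (hne : x j ≠ x' j) :
    ∃ (e : ((verticialLevelData_temperedPiChart (h36 := h37.toProp36Hypotheses)).tree j).Edge)
      (b b' : ((verticialLevelData_temperedPiChart (h36 := h37.toProp36Hypotheses)).tree j).Branch), b ≠ b' ∧
      ((verticialLevelData_temperedPiChart (h36 := h37.toProp36Hypotheses)).tree j).edgeOf b = e ∧
      ((verticialLevelData_temperedPiChart (h36 := h37.toProp36Hypotheses)).tree j).edgeOf b' = e ∧
      ((verticialLevelData_temperedPiChart (h36 := h37.toProp36Hypotheses)).tree j).abuts b = some (x j) ∧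
      ((verticialLevelData_temperedPiChart (h36 := h37.toProp36Hypotheses)).tree j).abuts b' = some (x' j) ∧
      ∀ g ∈ C, ((verticialLevelData_temperedPiChart (h36 := h37.toProp36Hypotheses)).act j g).hom.edgeMap e = e :=
  hadj_temperedPiChart_of_bounded_dist' h37 C hCc hC x x' hx hx' hfx hfx'
    (𝒢.hbdd_temperedPiChart_of_noCore h37 hNC C hC x x' hx hx' hfx hfx') j hne

/-- **The centraliser of a nontrivial compact subgroup of `π₁^temp(𝒢)` lies in each of its verticial hosts, at
every countable `𝒢` without core** satisfying the hypotheses of [SemiAnbd] Thm 3.7, for EVERY chart `c`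
(abc-iut-f-172's `centralizer_le_of_hadj` at the level data of `c` transported from the canonical tower, as in
`centralizer_le_verticial_of_tame`, with `hadj_temperedPiChart_of_noCore`).
[cite: MochizukiSemiAnbd2006, Thm 3.7(iii) pp.40-41] -/
theorem centralizer_le_verticial_of_noCore (h37 : 𝒢.Thm37Hypotheses)
    (hNC : ∀ S : Set 𝒢.graph.Vertex, S.Nonempty → ∃ w ∈ S,
      {b : 𝒢.graph.Branch | 𝒢.graph.abuts b = some w ∧ ∃ b', b' ≠ b ∧ 𝒢.graph.edgeOf b' = 𝒢.graph.edgeOf b ∧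
        ∃ w' ∈ S, 𝒢.graph.abuts b' = some w'}.Finite)
    (c : TemperedPiChart 𝒢) (C : Subgroup c.G) (hCc : IsCompact (C : Set c.G)) (hC : C ≠ ⊥)
    {v : 𝒢.graph.Vertex} {H : Subgroup c.G} (hH : H ∈ verticialSubgroups c v) (hCH : C ≤ H) :
    Subgroup.centralizer (C : Set c.G) ≤ H := by
  obtain ⟨φ, ψ, hψφ, hφψ, hφ, hψ⟩ :=
    TemperedPiChart.exists_compatIso (𝒢.temperedPiChart h37.toProp36Hypotheses) c
  let D₀ := verticialLevelData_temperedPiChart (h36 := h37.toProp36Hypotheses)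
  let D : VerticialLevelData.{0} 𝒢 c := D₀.transport φ ψ hψφ hφψ
    (fun v H => mem_verticialSubgroups_iff_map φ hφ ψ hφψ hψ H)
    (fun e L => mem_edgeLikeSubgroups_iff_map φ hφ ψ hφψ hψ L)
  exact D.centralizer_le_of_hadj verticialDistinct_holds h37 C
    (D₀.hadj_transport φ ψ hψφ hφψ _ _
      (fun C' hC'c hC' x x' hx hx' hfx hfx' j hne' =>
        𝒢.hadj_temperedPiChart_of_noCore h37 hNC C' hC'c hC' x x' hx hx' hfx hfx' j hne') C hCc hC)
    hH hCH

/-- **(R3c) F-2772 `EdgeLikeCentralizerAt ℋ c` at EVERY chart of EVERY graph of anabelioids `ℋ` satisfying the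
hypotheses of [SemiAnbd] Cor. 3.9 whose underlying graph has no infinitely-branching core** (p. 43 l. 13 "[again by
Theorem 3.7, (iii), (iv)]"): the centraliser of the image `ψ(U)` of an open `U ⊆ Π_e` under an edge homomorphism
`ψ` at `e` lies in every verticial subgroup containing it (`ψ(U)` is compact and non-trivial,
`isCompact_map_and_ne_bot_of_isEdgeHom`). [cite: MochizukiSemiAnbd2006, Cor 3.9 p.43] -/
theorem edgeLikeCentralizerAt_of_noCore (hℋ : Cor39Hypotheses ℋ)
    (hNC : ∀ S : Set ℋ.graph.Vertex, S.Nonempty → ∃ w ∈ S,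
      {b : ℋ.graph.Branch | ℋ.graph.abuts b = some w ∧ ∃ b', b' ≠ b ∧ ℋ.graph.edgeOf b' = ℋ.graph.edgeOf b ∧
        ∃ w' ∈ S, ℋ.graph.abuts b' = some w'}.Finite)
    (c : TemperedPiChart ℋ) : EdgeLikeCentralizerAt ℋ c := by
  intro e ψ hψ U hU v H hH hUH
  obtain ⟨hCc, hC⟩ := isCompact_map_and_ne_bot_of_isEdgeHom hℋ c e ψ hψ U hU
  exact ℋ.centralizer_le_verticial_of_noCore hℋ.thm37Hypotheses hNC c _ hCc hC hH hUH

/-- **F-2773 `EdgeLikeCentralizer` RESTRICTED to graphs without core, hypothesis-free**: for every graph of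
anabelioids satisfying the hypotheses of [SemiAnbd] Cor. 3.9 whose underlying graph has no infinitely-branching core
(in particular every locally finite graph, every TAME graph) and every chart, `EdgeLikeCentralizerAt`.  (The bare
∀-countable fact F-2773 additionally ranges over graphs WITH a core, not treated here.)
[cite: MochizukiSemiAnbd2006, Cor 3.9 p.43] -/
theorem edgeLikeCentralizer_of_noCore :
    ∀ (ℋ : ProfiniteSemiGraph.{u}), Cor39Hypotheses ℋ →
      (∀ S : Set ℋ.graph.Vertex, S.Nonempty → ∃ w ∈ S,
        {b : ℋ.graph.Branch | ℋ.graph.abuts b = some w ∧ ∃ b', b' ≠ b ∧ ℋ.graph.edgeOf b' = ℋ.graph.edgeOf b ∧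
          ∃ w' ∈ S, ℋ.graph.abuts b' = some w'}.Finite) →
      ∀ (c : TemperedPiChart ℋ), EdgeLikeCentralizerAt ℋ c :=
  fun _ hℋ hNC c => edgeLikeCentralizerAt_of_noCore hℋ hNC c

end Canonical

end ProfiniteSemiGraph

end Literature.AnabelianGeometry.SemiGraphs
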